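import Literature.Geometry.Lorentzian.CoordShrinkerRmDrift
import HarnessLib

/-!
# Line `collapsed-ends-usc` of crux `EntropyRung.NoncompactShrinkerGap`: stub `helper_mwRmDriftChart`

Lead c14 of the crux line (item stmt-SmoothPoincare4-10868), programme "Munteanu–Wang 2015,
Thm. 1.4" (a complete four-dimensional gradient shrinker with bounded scalar curvature has bounded
curvature), brick 1 of route item 16588 (splitting at infinity). The registered stub
`helper_mwRmDriftChart` is the pointwise chart inequality behind the last step of the proof of
Munteanu–Wang's Thm. 1.4 (p. 6: "`Δ_f|Rm| ≥ −c|Rm|²`", "`v := |Rm| + |Ric|²` satisfies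
`Δ_f v ≥ ½v² − c`"), in the smooth variant `v = √(|Rm|² + 1) + |Ric|²` and with explicit constants:
on a normalised gradient shrinker `Ric + Hess f = ½ G` in a chart (metric components `G` on `V`,
positive definite at `x`), GIVEN at `x` the conclusions of the sibling stubs — Prop. 1.1
(`|∇f|²|Rm|² ≤ 16|∇f|²|Ric|² + 64|∇Ric|²`), (1.10) (`Δ_f|Ric|² ≥ 2|∇Ric|² + 2|Ric|² − 4|Rm||Ric|²`) and
the `|Rm|²` drift inequality (`∃ N ≥ 0, Δ_f|Rm|² ≥ 2N − C₅(|Rm|+1)|Rm|², |∇|Rm|²|² ≤ 4|Rm|²N`) — and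
the bounds `|Ric|² ≤ B`, `|∇f|² ≥ 32(C₅+1)`:

  `Δ_f v ≥ ¼ v² − ((C₅ + 1)(16B + 1) + 9B²)`.

It is the Literature theorem
`Literature.Geometry.Lorentzian.MetricCoord.IsMetricOn.mw_drift_sqrt_rmNormSqAt_add_normSqAt_ricAt`
(`CoordShrinkerRmDrift.lean`: local chain rule for `√(t+1)`, linearity of the drift Laplacian, and
the real arithmetic of the proof with the case distinction `ρ² ≥ 16B + 1` or not), specialised to a
`Fin 4`-basis; the hypotheses `ContDiffOn ℝ ∞ f V` and the soliton equation are not used beyond the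
displayed inputs.

## References

* O. Munteanu, J. Wang, *Geometry of shrinking Ricci solitons*, Compositio Math. 151 (2015)
  = arXiv:1410.3813, Thm. 1.4 and its proof (p. 6). [MunteanuWang2015]
-/

noncomputable section

-- `Summit.SmoothPoincare4.SmoothPoincare4.…` (summit = problem) trips `dupNamespace` on every decl.
set_option linter.dupNamespace false

open scoped ContDiff Topology
open Set Filter Module
open Literature.Geometry.Lorentzian

namespace Summit.SmoothPoincare4.SmoothPoincare4.Theorems.NoncompactShrinkerGapMW

/-- **Stub `helper_mwRmDriftChart` (Munteanu–Wang 2015, Thm. 1.4 at a point, PROVED)**: on a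
normalised gradient shrinker in a chart (metric components `G` on `V`, positive definite at `x ∈ V`),
in a basis `b` of the four-dimensional model space, given Prop. 1.1, (1.10), the `|Rm|²` drift
inequality with constant `C₅ ≥ 0`, `|Ric|² ≤ B` and `|∇f|² ≥ 32(C₅ + 1)` at `x`: for
`v = √(|Rm|² + 1) + |Ric|²`, `¼ v² − ((C₅+1)(16B+1) + 9B²) ≤ Δv − dv(♯Df)`.
[cite: MunteanuWang2015, Thm. 1.4 (proof)] -/
theorem helper_mwRmDriftChart : ∀ {E : Type} [NormedAddCommGroup E] [NormedSpace ℝ E] [FiniteDimensional ℝ E] [CompleteSpace E] (G : E → E →L[ℝ] E →L[ℝ] ℝ) (V : Set E) (x : E) (f : E → ℝ) (b : Module.Basis (Fin 4) ℝ E) (C₅ B : ℝ), MetricCoord.IsMetricOn G V → x ∈ V → (∀ v : E, v ≠ 0 → 0 < G x v v) → ContDiffOn ℝ ∞ f V → (∀ y ∈ V, ∀ v w : E, MetricCoord.ricAt G y v w + MetricCoord.hessAt G f y v w = (1 / 2 : ℝ) * G y v w) → 0 ≤ C₅ → 0 ≤ B → MetricCoord.normSqAt G x (MetricCoord.ricAt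 G x) ≤ B → 32 * (C₅ + 1) ≤ MetricCoord.gradSqAt G f x → MetricCoord.gradSqAt G f x * MetricCoord.rmNormSqAt G x ≤ 16 * MetricCoord.gradSqAt G f x * MetricCoord.normSqAt G x (MetricCoord.ricAt G x) + 64 * ∑ k, ∑ l, MetricCoord.ginv G b x k l * MetricCoord.pairAt G x (MetricCoord.cov₂At G (MetricCoord.ricAt G) x (b k)) (MetricCoord.cov₂At G (MetricCoord.ricAt G) x (b l)) → 2 * (∑ k, ∑ l, MetricCoord.ginv G b x k l * MetricCoord.pairAt G x (MetricCoord.cov₂At G (MetricCoord.ricAt G) x (b k)) (MetricCoord.cov₂At G (MetricCoord.ricAt G) x (b l))) + 2 * MetricCoord.normSqAt G x (MetricCoord.ricAt G x) - 4 * Real.sqrt (MetricCoord.rmNormSqAt G x) * MetricCoord.normSqAt G x (MetricCoord.ricAt G x) ≤ MetricCoord.lapAt G (fun y ↦ MetricCoord.normSqAt G y (MetricCoord.ricAt G y)) x - fderiv ℝ (fun y ↦ MetricCoord.normSqAt G y (MetricCoord.ricAt G y)) x (MetricCoord.sharpAt G x (fderiv ℝ f x)) → (∃ N : ℝ, 0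 ≤ N ∧ 2 * N - C₅ * (Real.sqrt (MetricCoord.rmNormSqAt G x) + 1) * MetricCoord.rmNormSqAt G x ≤ MetricCoord.lapAt G (MetricCoord.rmNormSqAt G) x - fderiv ℝ (MetricCoord.rmNormSqAt G) x (MetricCoord.sharpAt G x (fderiv ℝ f x)) ∧ MetricCoord.gradSqAt G (MetricCoord.rmNormSqAt G) x ≤ 4 * MetricCoord.rmNormSqAt G x * N) → 1 / 4 * ((MetricCoord.rmNormSqAt G x + 1) ^ ((1 / 2 : ℝ)) + MetricCoord.normSqAt G x (MetricCoord.ricAt G x)) ^ 2 - ((C₅ + 1) * (16 * B + 1) + 9 * B ^ 2) ≤ MetricCoord.lapAt G (fun y ↦ (MetricCoord.rmNormSqAt G y + 1) ^ ((1 / 2 : ℝ)) + MetricCoord.normSqAt G y (MetricCoord.ricAt G y)) x - fderiv ℝ (fun y ↦ (MetricCoord.rmNormSqAt G y + 1) ^ ((1 / 2 : ℝ)) + MetricCoord.normSqAt G y (MetricCoord.ricAt G y)) x (MetricCoord.sharpAt G x (fderiv ℝ f x)) := by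
  intro E _ _ _ _ G V x f b C₅ B hG hx hpos _ _ hC hB hRB hq hP hL hN
  exact hG.mw_drift_sqrt_rmNormSqAt_add_normSqAt_ricAt hx hpos f b hC hB hRB hq hP hL hN

end Summit.SmoothPoincare4.SmoothPoincare4.Theorems.NoncompactShrinkerGapMW

end
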